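import Mathlib
import Summits.ValiantsHypothesis.ValiantsHypothesis.Theorems.BarrierLeverPartitionMinorsHitByVPHiddenStatesTripleRank

/-!
# Route BarrierLever — item `PartitionMinorsHitByVP` (stmt-ValiantsHypothesis-19717):
# the FIVE-ROW RANK BOUND — rows of size ≤ 5 on few vertices against a two-layer hidden family

Helper file (`--supports stmt-ValiantsHypothesis-19717`; cell valiant-natproofs, rung V4, 𝒟-side door (c), line
`hidden-states`; prover seat val-np-p4 gen 15). Definition-free apart from plain bookkeeping `def`s (an index set, the
column-functions and the coefficients; no mathematical content). Closes NO item; it is the engine of the seat's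
refutation of the single-cube conjecture `stub_qstarCube` (Q\*(h³)) of the registered line
`Cruxes/PartitionMinorsHitByVP/Lines/hidden_states.lean` (file `…HiddenStatesQstarCubeRefutation`).

THE BOUND (the odd-uniform, vertex-sparse form of val-np-p3 g9's triple-row bound `…HiddenStatesTripleRank`). Let
`e : n → Finset (Fin K)` be a TWO-LAYER hidden family (members of size `≤ 2`, every two-state member inside a fixed set
`S` of states) and let every row `u i` have at most FIVE coordinates, all inside a fixed set `T` of coordinates. For a
pair column `e k = {p < p'}` the binomial expansion (`Finset.prod_add`)

  `∏_{a ∈ U} (c_a + x_a + y_a) = Σ_{V ⊆ U} (∏_{a ∈ V} y_a) · ∏_{a ∈ U ∖ V} (c_a + x_a)`   (`c = tx none`, `x = tx p`, `y = tx p'`)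

has, for `|U| ≤ 5`, either `|V| ≤ 2` or `|U ∖ V| ≤ 2`; so EVERY row is a fixed linear combination of the
`(K + 1) + 2·|S|·#{V ⊆ T : |V| ≤ 2}` column-functions `k ↦ [e k = ∅]`, `k ↦ [e k = {q}]`,
`k ↦ [e k = {p < p'}]·∏_{a∈V} y_a` and `k ↦ [e k = {p' < p}]·∏_{a∈V}(c_a + x_a)` (`p ∈ S`, `V ⊆ T`, `|V| ≤ 2`)
(`row_eq_sum_coef`, `row_mem_span`). Consequently (`det_eq_zero_of_rows_le_five`): if the number of rows exceeds
`(K + 1) + 2·|S|·#{V ⊆ T : |V| ≤ 2}`, the additive matrix `[∏_{a ∈ u i}(tx none a + Σ_{q ∈ e k} tx (some q) a)]_{i,k}` is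
SINGULAR FOR EVERY TABLE. With `|T| = n` the count is `≤ (K+1) + 2|S|(n+1)²` (`card_smallSub_le`), independent of `h`
and cubic-free in `n`, while `C(n,5)` rows of size five are available: this is what lets the refutation file defeat the
single cube at EVERY state count `K ≤ h⁴` (the triple-row bound stops at `K ≈ h³/6`).

Contents: `smallSub`/`card_smallSub_le`; `ColIdx`, `colVec`, `coef` (bookkeeping); `row_eq_sum_coef`, `row_mem_span`;
`det_eq_zero_of_rows_le_five` (THE BOUND, dimension count as in `TripleRank`). WHAT THIS IS NOT: nothing on joins
(`stub_qjoinSharp`, `stub_universalJoinWide`: a join of `m` pieces multiplies the pair budget by `m`), 14610 or VP ≠ VNP.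
-/

set_option linter.dupNamespace false

namespace Summit.ValiantsHypothesis.ValiantsHypothesis.Theorems.BarrierLever.HiddenStates

open Finset Matrix

noncomputable section

namespace FiveRank

open TripleRank (lin lin_empty lin_singleton lin_pair)

variable {K h : ℕ} {n : Type*}

/-! ## The small subsets of the vertex set -/

/-- The subsets of `T` of size at most two (index of the pair column-functions). -/
def smallSub (T : Finset (Fin h)) : Finset (Finset (Fin h)) := T.powerset.filter fun V => V.card ≤ 2

/-- Membership in `smallSub T`. -/
theorem mem_smallSub {T V : Finset (Fin h)} : V ∈ smallSub T ↔ V ⊆ T ∧ V.card ≤ 2 := by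
  simp [smallSub]

/-- `|smallSub T| ≤ (|T| + 1)²`. -/
theorem card_smallSub_le (T : Finset (Fin h)) : (smallSub T).card ≤ (T.card + 1) ^ 2 := by
  classical
  have hsub : smallSub T ⊆ (Finset.range 3).biUnion fun i => T.powersetCard i := by
    intro V hV
    rw [mem_smallSub] at hV
    rw [Finset.mem_biUnion]
    exact ⟨V.card, Finset.mem_range.mpr (by omega), Finset.mem_powersetCard.mpr ⟨hV.1, rfl⟩⟩
  have hsum : ∑ i ∈ Finset.range 3, (T.powersetCard i).card = 1 + T.card + T.card.choose 2 := by
    simp only [Finset.sum_range_succ, Finset.sum_range_zero, Finset.card_powersetCard, Nat.choose_zero_right,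
      Nat.choose_one_right]
  have hch : T.card.choose 2 ≤ T.card * T.card := by
    rw [Nat.choose_two_right]
    exact (Nat.div_le_self _ _).trans (Nat.mul_le_mul_left _ (Nat.sub_le _ _))
  calc (smallSub T).card ≤ ((Finset.range 3).biUnion fun i => T.powersetCard i).card := Finset.card_le_card hsub
    _ ≤ ∑ i ∈ Finset.range 3, (T.powersetCard i).card := Finset.card_biUnion_le
    _ = 1 + T.card + T.card.choose 2 := hsum
    _ ≤ (T.card + 1) ^ 2 := by nlinarith [hch]

/-! ## Column-functions and coefficients -/

/-- The index type of the column-functions: `none` (the empty column), `some q` (the singleton column `{q}`), and two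
families of pair functions indexed by a state of `S` and a small subset of `T`. -/
abbrev ColIdx (K h : ℕ) (S : Finset (Fin K)) (T : Finset (Fin h)) :=
  Option (Fin K) ⊕ ((S × smallSub T) ⊕ (S × smallSub T))

/-- The column-functions as vectors indexed by the columns `k : n`. -/
def colVec (e : n → Finset (Fin K)) (S : Finset (Fin K)) (T : Finset (Fin h))
    (tx : Option (Fin K) → Fin h → ℂ) : ColIdx K h S T → (n → ℂ)
  | Sum.inl none => fun k => if e k = ∅ then 1 else 0
  | Sum.inl (some q) => fun k => if e k = {q} then 1 else 0
  | Sum.inr (Sum.inl (p, V)) => fun k =>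
      if (e k).card = 2 ∧ (p : Fin K) ∈ e k ∧ (∀ q ∈ e k, (p : Fin K) ≤ q) then
        ∏ a ∈ (V : Finset (Fin h)), ∑ q ∈ (e k).erase p, tx (some q) a
      else 0
  | Sum.inr (Sum.inr (p, W)) => fun k =>
      if (e k).card = 2 ∧ (p : Fin K) ∈ e k ∧ (∀ q ∈ e k, q ≤ (p : Fin K)) then
        ∏ a ∈ (W : Finset (Fin h)), (tx none a + ∑ q ∈ (e k).erase p, tx (some q) a)
      else 0

/-- The coefficient vector of the row `U` on the column-functions. -/
def coef (tx : Option (Fin K) → Fin h → ℂ) (S : Finset (Fin K)) (T : Finset (Fin h)) (U : Finset (Fin h)) :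
    ColIdx K h S T → ℂ
  | Sum.inl none => ∏ a ∈ U, tx none a
  | Sum.inl (some q) => ∏ a ∈ U, (tx none a + tx (some q) a)
  | Sum.inr (Sum.inl (p, V)) =>
      if (V : Finset (Fin h)) ⊆ U then ∏ a ∈ U \ V, (tx none a + tx (some (p : Fin K)) a) else 0
  | Sum.inr (Sum.inr (p, W)) =>
      if (W : Finset (Fin h)) ⊆ U ∧ 3 ≤ (U \ W).card then ∏ a ∈ U \ W, tx (some (p : Fin K)) a else 0

section colfacts

variable (e : n → Finset (Fin K)) (S : Finset (Fin K)) (T : Finset (Fin h)) (tx : Option (Fin K) → Fin h → ℂ)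

/-- The left pair function vanishes off the pair columns. -/
theorem colVec_pairL_of_card_ne_two (s : S) (V : smallSub T) (k : n) (hk : (e k).card ≠ 2) :
    colVec e S T tx (Sum.inr (Sum.inl (s, V))) k = 0 := by
  simp [colVec, hk]

/-- The right pair function vanishes off the pair columns. -/
theorem colVec_pairR_of_card_ne_two (s : S) (W : smallSub T) (k : n) (hk : (e k).card ≠ 2) :
    colVec e S T tx (Sum.inr (Sum.inr (s, W))) k = 0 := by
  simp [colVec, hk]

/-- The left pair function at a pair column `{p < p'}`: it fires for `s = p` only, with value `∏_{a∈V} tx p' a`. -/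
theorem colVec_pairL_pair (s : S) (V : smallSub T) (k : n) {p p' : Fin K} (hpp : p < p') (hk : e k = {p, p'}) :
    colVec e S T tx (Sum.inr (Sum.inl (s, V))) k =
      if (s : Fin K) = p then ∏ a ∈ (V : Finset (Fin h)), tx (some p') a else 0 := by
  have hne : p ≠ p' := ne_of_lt hpp
  have hcard : (e k).card = 2 := by rw [hk]; exact Finset.card_pair hne
  by_cases hs : (s : Fin K) = p
  · have hcond : (e k).card = 2 ∧ (s : Fin K) ∈ e k ∧ (∀ q ∈ e k, (s : Fin K) ≤ q) := by
      refine ⟨hcard, ?_, ?_⟩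
      · rw [hk, hs]; simp
      · intro q hq
        rw [hk] at hq
        rw [hs]
        rcases Finset.mem_insert.mp hq with rfl | hq'
        · exact le_rfl
        · rw [Finset.mem_singleton.mp hq']; exact le_of_lt hpp
    simp only [colVec, if_pos hcond, if_pos hs]
    rw [hk, hs, Finset.erase_insert (by simpa using hne)]
    simp
  · have hcond : ¬ ((e k).card = 2 ∧ (s : Fin K) ∈ e k ∧ (∀ q ∈ e k, (s : Fin K) ≤ q)) := by
      rintro ⟨-, hmem, hle⟩
      rw [hk] at hmem hle
      rcases Finset.mem_insert.mp hmem with h1 | h2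
      · exact hs h1
      · have h2' : (s : Fin K) = p' := Finset.mem_singleton.mp h2
        have := hle p (by simp)
        rw [h2'] at this
        exact absurd hpp (not_lt.mpr this)
    simp only [colVec, if_neg hcond, if_neg hs]

/-- The right pair function at a pair column `{p < p'}`: it fires for `s = p'` only, with value `∏_{a∈W}(tx none a + tx p a)`. -/
theorem colVec_pairR_pair (s : S) (W : smallSub T) (k : n) {p p' : Fin K} (hpp : p < p') (hk : e k = {p, p'}) :
    colVec e S T tx (Sum.inr (Sum.inr (s, W))) k =
      if (s : Fin K) = p' then ∏ a ∈ (W : Finset (Fin h)), (tx none a + tx (some p) a) else 0 := by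
  have hne : p ≠ p' := ne_of_lt hpp
  have hcard : (e k).card = 2 := by rw [hk]; exact Finset.card_pair hne
  by_cases hs : (s : Fin K) = p'
  · have hcond : (e k).card = 2 ∧ (s : Fin K) ∈ e k ∧ (∀ q ∈ e k, q ≤ (s : Fin K)) := by
      refine ⟨hcard, ?_, ?_⟩
      · rw [hk, hs]; simp
      · intro q hq
        rw [hk] at hq
        rw [hs]
        rcases Finset.mem_insert.mp hq with rfl | hq'
        · exact le_of_lt hpp
        · rw [Finset.mem_singleton.mp hq']
    simp only [colVec, if_pos hcond, if_pos hs]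
    rw [hk, hs, Finset.pair_comm, Finset.erase_insert (by simpa using hne.symm)]
    simp
  · have hcond : ¬ ((e k).card = 2 ∧ (s : Fin K) ∈ e k ∧ (∀ q ∈ e k, q ≤ (s : Fin K))) := by
      rintro ⟨-, hmem, hle⟩
      rw [hk] at hmem hle
      rcases Finset.mem_insert.mp hmem with h1 | h2
      · have := hle p' (by simp)
        rw [h1] at this
        exact absurd hpp (not_lt.mpr this)
      · exact hs (Finset.mem_singleton.mp h2)
    simp only [colVec, if_neg hcond, if_neg hs]

end colfacts

/-! ## Every row of size ≤ 5 inside `T` is a combination of the column-functions -/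

section span

variable (u : n → Finset (Fin h)) (e : n → Finset (Fin K)) (S : Finset (Fin K)) (T : Finset (Fin h))
  (tx : Option (Fin K) → Fin h → ℂ)

/-- Sums over `smallSub T` with an indicator `V ⊆ U` are sums over the small subsets of `U` (for `U ⊆ T`). -/
theorem sum_smallSub_ite_subset (U : Finset (Fin h)) (hUT : U ⊆ T) (F : Finset (Fin h) → ℂ) :
    ∑ V : smallSub T, (if (V : Finset (Fin h)) ⊆ U then F V else 0) =
      ∑ V ∈ U.powerset.filter (fun V => V.card ≤ 2), F V := by
  classical
  rw [Finset.sum_coe_sort (smallSub T) (fun V => if V ⊆ U then F V else 0), ← Finset.sum_filter]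
  apply Finset.sum_congr _ (fun _ _ => rfl)
  ext V
  simp only [Finset.mem_filter, mem_smallSub, Finset.mem_powerset]
  constructor
  · rintro ⟨⟨-, hc⟩, hVU⟩
    exact ⟨hVU, hc⟩
  · rintro ⟨hVU, hc⟩
    exact ⟨⟨hVU.trans hUT, hc⟩, hVU⟩

/-- Sums over `smallSub T` with the indicator `W ⊆ U ∧ 3 ≤ |U ∖ W|` are sums over the subsets of `U` with a large
complement (for `U ⊆ T`, `|U| ≤ 5`). -/
theorem sum_smallSub_ite_large (U : Finset (Fin h)) (hUT : U ⊆ T) (hU : U.card ≤ 5) (G : Finset (Fin h) → ℂ) :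
    ∑ W : smallSub T, (if (W : Finset (Fin h)) ⊆ U ∧ 3 ≤ (U \ W).card then G W else 0) =
      ∑ W ∈ U.powerset.filter (fun W => 3 ≤ (U \ W).card), G W := by
  classical
  rw [Finset.sum_coe_sort (smallSub T) (fun W => if W ⊆ U ∧ 3 ≤ (U \ W).card then G W else 0),
    ← Finset.sum_filter]
  apply Finset.sum_congr _ (fun _ _ => rfl)
  ext W
  simp only [Finset.mem_filter, mem_smallSub, Finset.mem_powerset]
  constructor
  · rintro ⟨⟨-, -⟩, hWU, h3⟩
    exact ⟨hWU, h3⟩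
  · rintro ⟨hWU, h3⟩
    have hcs : (U \ W).card = U.card - W.card := Finset.card_sdiff_of_subset hWU
    exact ⟨⟨hWU.trans hUT, by omega⟩, hWU, h3⟩

/-- **The row identity.** For a two-layer hidden family with pairs inside `S`, every row `i` with `|u i| ≤ 5` and
`u i ⊆ T` of the additive matrix is, as a function of the column `k`, the fixed combination
`Σ_idx coef(idx) · colVec(idx)` of the column-functions. -/
theorem row_eq_sum_coef (he2 : ∀ k, (e k).card ≤ 2) (heS : ∀ k, (e k).card = 2 → e k ⊆ S)
    (i : n) (hi : (u i).card ≤ 5) (hiT : u i ⊆ T) (k : n) :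
    ∏ a ∈ u i, lin tx a (e k) = ∑ idx : ColIdx K h S T, coef tx S T (u i) idx * colVec e S T tx idx k := by
  classical
  rw [Fintype.sum_sum_type, Fintype.sum_sum_type, Fintype.sum_option, Fintype.sum_prod_type,
    Fintype.sum_prod_type]
  rcases Nat.lt_or_ge (e k).card 1 with h0 | h1
  · -- the empty column
    have hJ : e k = ∅ := Finset.card_eq_zero.mp (by omega)
    have hL := fun (s : S) (V : smallSub T) => colVec_pairL_of_card_ne_two e S T tx s V k (by rw [hJ]; simp)
    have hR := fun (s : S) (W : smallSub T) => colVec_pairR_of_card_ne_two e S T tx s W k (by rw [hJ]; simp)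
    simp only [hL, hR, mul_zero, Finset.sum_const_zero, add_zero]
    simp only [coef, colVec, hJ, if_true, mul_one]
    have hsing : ∀ q : Fin K, ¬ ((∅ : Finset (Fin K)) = {q}) := fun q h => (Finset.singleton_ne_empty q) h.symm
    simp [hsing, lin]
  rcases Nat.lt_or_ge (e k).card 2 with h1' | h2
  · -- a singleton column
    have hJ1 : (e k).card = 1 := by omega
    obtain ⟨q₀, hq₀⟩ := Finset.card_eq_one.mp hJ1
    have hL := fun (s : S) (V : smallSub T) => colVec_pairL_of_card_ne_two e S T tx s V k (by omega)
    have hR := fun (s : S) (W : smallSub T) => colVec_pairR_of_card_ne_two e S T tx s W k (by omega)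
    simp only [hL, hR, mul_zero, Finset.sum_const_zero, add_zero]
    simp only [coef, colVec, hq₀, Finset.singleton_ne_empty, if_false, mul_zero, zero_add,
      Finset.singleton_inj, mul_boole]
    rw [Finset.sum_ite_eq Finset.univ q₀]
    simp [lin]
  · -- a pair column `{p, p'} ⊆ S`
    have hJ2 : (e k).card = 2 := le_antisymm (he2 k) h2
    have hsub : e k ⊆ S := heS k hJ2
    obtain ⟨p₁, p₂, hne, hJ⟩ := Finset.card_eq_two.mp hJ2
    -- order the two states
    obtain ⟨p, p', hpp, hJ'⟩ : ∃ p p' : Fin K, p < p' ∧ e k = {p, p'} := by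
      rcases lt_or_gt_of_ne hne with hlt | hgt
      · exact ⟨p₁, p₂, hlt, hJ⟩
      · exact ⟨p₂, p₁, hgt, by rw [hJ, Finset.pair_comm]⟩
    clear hJ hne p₁ p₂
    have hne : p ≠ p' := ne_of_lt hpp
    have hpS : p ∈ S := hsub (by rw [hJ']; simp)
    have hp'S : p' ∈ S := hsub (by rw [hJ']; simp)
    -- the constant and singleton blocks vanish
    have hnone : (if e k = ∅ then (1 : ℂ) else 0) = 0 := by
      rw [if_neg]; rw [hJ']; exact Finset.Nonempty.ne_empty (by simp)
    have hsome : ∀ q : Fin K, (if e k = {q} then (1 : ℂ) else 0) = 0 := fun q => by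
      refine if_neg fun hq => ?_
      have := congrArg Finset.card hq
      rw [hJ2, Finset.card_singleton] at this
      omega
    -- the two pair blocks (rewrite them while `colVec` is still folded)
    simp only [show ∀ (s : S) (V : smallSub T), colVec e S T tx (Sum.inr (Sum.inl (s, V))) k =
        if (s : Fin K) = p then ∏ a ∈ (V : Finset (Fin h)), tx (some p') a else 0 from
      fun s V => colVec_pairL_pair e S T tx s V k hpp hJ',
      show ∀ (s : S) (W : smallSub T), colVec e S T tx (Sum.inr (Sum.inr (s, W))) k =
        if (s : Fin K) = p' then ∏ a ∈ (W : Finset (Fin h)), (tx none a + tx (some p) a) else 0 from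
      fun s W => colVec_pairR_pair e S T tx s W k hpp hJ']
    simp only [coef, colVec, hnone, hsome, mul_zero, Finset.sum_const_zero, zero_add]
    -- collapse the sums over `s : S` to the single firing state
    rw [Fintype.sum_eq_single (⟨p, hpS⟩ : S) (fun s hs => by
      have hs' : (s : Fin K) ≠ p := fun h' => hs (Subtype.ext h')
      simp [hs']),
      Fintype.sum_eq_single (⟨p', hp'S⟩ : S) (fun s hs => by
      have hs' : (s : Fin K) ≠ p' := fun h' => hs (Subtype.ext h')
      simp [hs'])]
    simp only [if_true]
    -- move the indicators outside
    have hL : ∑ V : smallSub T, (if (V : Finset (Fin h)) ⊆ u i then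
          ∏ a ∈ u i \ V, (tx none a + tx (some p) a) else 0) * ∏ a ∈ (V : Finset (Fin h)), tx (some p') a =
        ∑ V ∈ (u i).powerset.filter (fun V => V.card ≤ 2),
          (∏ a ∈ V, tx (some p') a) * ∏ a ∈ u i \ V, (tx none a + tx (some p) a) := by
      rw [← sum_smallSub_ite_subset T (u i) hiT]
      apply Finset.sum_congr rfl
      intro V _
      split_ifs <;> ring
    have hR : ∑ W : smallSub T, (if (W : Finset (Fin h)) ⊆ u i ∧ 3 ≤ (u i \ W).card then
          ∏ a ∈ u i \ W, tx (some p') a else 0) * ∏ a ∈ (W : Finset (Fin h)), (tx none a + tx (some p) a) =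
        ∑ W ∈ (u i).powerset.filter (fun W => 3 ≤ (u i \ W).card),
          (∏ a ∈ u i \ W, tx (some p') a) * ∏ a ∈ W, (tx none a + tx (some p) a) := by
      rw [← sum_smallSub_ite_large T (u i) hiT hi]
      apply Finset.sum_congr rfl
      intro W _
      split_ifs <;> ring
    rw [hL, hR]
    -- the binomial expansion of the row at the pair column
    have hlhs : ∏ a ∈ u i, lin tx a (e k) = ∏ a ∈ u i, (tx (some p') a + (tx none a + tx (some p) a)) := by
      apply Finset.prod_congr rfl
      intro a _
      rw [hJ', lin_pair tx a hne]
      ring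
    rw [hlhs, Finset.prod_add, ← Finset.sum_filter_add_sum_filter_not _ (fun V => V.card ≤ 2)]
    congr 1
    -- reindex the large part by complementation inside `u i`
    symm
    refine Finset.sum_nbij' (fun W => u i \ W) (fun V => u i \ V) ?_ ?_ ?_ ?_ ?_
    · intro W hW
      simp only [Finset.mem_filter, Finset.mem_powerset] at hW ⊢
      refine ⟨Finset.sdiff_subset, ?_⟩
      omega
    · intro V hV
      simp only [Finset.mem_filter, Finset.mem_powerset] at hV ⊢
      refine ⟨Finset.sdiff_subset, ?_⟩
      rw [Finset.sdiff_sdiff_eq_self hV.1]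
      have hcs : (u i \ V).card = (u i).card - V.card := Finset.card_sdiff_of_subset hV.1
      have hVc : V.card ≤ (u i).card := Finset.card_le_card hV.1
      omega
    · exact fun W hW => Finset.sdiff_sdiff_eq_self (Finset.mem_powerset.mp (Finset.mem_filter.mp hW).1)
    · exact fun V hV => Finset.sdiff_sdiff_eq_self (Finset.mem_powerset.mp (Finset.mem_filter.mp hV).1)
    · intro W hW
      rw [Finset.sdiff_sdiff_eq_self (Finset.mem_powerset.mp (Finset.mem_filter.mp hW).1)]

/-- **Every row of size ≤ 5 inside `T` lies in the span of the column-functions.** -/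
theorem row_mem_span (he2 : ∀ k, (e k).card ≤ 2) (heS : ∀ k, (e k).card = 2 → e k ⊆ S)
    (i : n) (hi : (u i).card ≤ 5) (hiT : u i ⊆ T) :
    (fun k => ∏ a ∈ u i, lin tx a (e k)) ∈ Submodule.span ℂ (Set.range (colVec e S T tx)) := by
  classical
  have hfun : (fun k => ∏ a ∈ u i, lin tx a (e k)) =
      ∑ idx : ColIdx K h S T, coef tx S T (u i) idx • colVec e S T tx idx := by
    funext k
    rw [row_eq_sum_coef u e S T tx he2 heS i hi hiT k, Finset.sum_apply]
    rfl
  rw [hfun]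
  exact Submodule.sum_mem _ fun idx _ => Submodule.smul_mem _ _ (Submodule.subset_span ⟨idx, rfl⟩)

end span

/-! ## The singular conclusion -/

section determinant

variable [Fintype n] [DecidableEq n]
variable (u : n → Finset (Fin h)) (e : n → Finset (Fin K)) (S : Finset (Fin K)) (T : Finset (Fin h))

/-- The number of column-functions is `(K + 1) + 2·|S|·|smallSub T|`. -/
theorem card_colIdx : Fintype.card (ColIdx K h S T) = (K + 1) + 2 * (S.card * (smallSub T).card) := by
  simp only [ColIdx, Fintype.card_sum, Fintype.card_option, Fintype.card_prod, Fintype.card_fin, Fintype.card_coe]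
  ring

/-- **THE FIVE-ROW RANK BOUND, singular form.** If the hidden family is two-layer with its pairs inside `S`, every
row has size `≤ 5` and lies inside `T`, and there are MORE than `(K + 1) + 2·|S|·|smallSub T|` rows, then the additive
matrix is singular for EVERY table. -/
theorem det_eq_zero_of_rows_le_five (he2 : ∀ k, (e k).card ≤ 2) (heS : ∀ k, (e k).card = 2 → e k ⊆ S)
    (hu5 : ∀ i, (u i).card ≤ 5) (huT : ∀ i, u i ⊆ T)
    (hcount : (K + 1) + 2 * (S.card * (smallSub T).card) < Fintype.card n)
    (tx : Option (Fin K) → Fin h → ℂ) :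
    (Matrix.of fun i k : n => ∏ a ∈ u i, (tx none a + ∑ q ∈ e k, tx (some q) a)).det = 0 := by
  classical
  set M : Matrix n n ℂ := Matrix.of fun i k : n => ∏ a ∈ u i, (tx none a + ∑ q ∈ e k, tx (some q) a) with hM
  by_contra hdet
  have hunit : IsUnit M := (Matrix.isUnit_iff_isUnit_det M).mpr (isUnit_iff_ne_zero.mpr hdet)
  have hrows : LinearIndependent ℂ (fun i : n => M i) := Matrix.linearIndependent_rows_of_isUnit hunit
  set W : Submodule ℂ (n → ℂ) := Submodule.span ℂ (Set.range (colVec e S T tx)) with hW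
  have hmem : ∀ i : n, M i ∈ W := by
    intro i
    have : M i = fun k => ∏ a ∈ u i, lin tx a (e k) := by
      funext k; rw [hM]; rfl
    rw [this]
    exact row_mem_span u e S T tx he2 heS i (hu5 i) (huT i)
  let w : n → W := fun i => ⟨M i, hmem i⟩
  have hw : LinearIndependent ℂ w := by
    apply LinearIndependent.of_comp W.subtype
    exact hrows
  have h1 : Fintype.card n ≤ Module.finrank ℂ W := hw.fintype_card_le_finrank
  have h2 : Module.finrank ℂ W ≤ Fintype.card (ColIdx K h S T) := finrank_range_le_card (colVec e S T tx)
  rw [card_colIdx] at h2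
  omega

end determinant

end FiveRank

end

end Summit.ValiantsHypothesis.ValiantsHypothesis.Theorems.BarrierLever.HiddenStates
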